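import Summits.CriticalPhenomena.PercolationContinuityZ3.Theorems.Transplant.SkelPhiPsiSteps
import HarnessLib

/-!
# Quasi-step rung (N3-b), LEVEL 0/1 interface, device (D2) of WAVE-Q-MANIFEST v0.1a §4 made kernel: from `Skelφ.PsiSteps G ψ M` the `K`-CELL MAP `w ↦ ⌊ψ w / K⌋`
# (`K ≥ 2`) has unit moves in every direction realised by walks of length `≤ M·K` with EXACT END CELL and a FAT footprint — every vertex of the walk lies in a
# cell within `±1` of the start cell in both coordinates (the 'fat link' the exact-footprint readers must be re-read with; the exact inner footprint of
# `Skelφ.LinkN` is NOT obtainable — the start of a link cannot be kept off the cell walls)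

builds on p205010 (kernel theorem, internal audit signed; external expert review pending) — nothing in this file uses p205010; nothing here is a claim about any open node; no carrier,
no node, no definition (the cell map is written inline, as `PlanarSkeletonFrmScaled.coarse` is).  Lane `prim-bschramm`, seat `prim-bschramm-gen-1` (gen 4; GEN pen).  Helper file
(`--supports stmt-CriticalPhenomena-4575 --as helper`).
WHY (HOME/WAVE-Q-MANIFEST.md §4 item Q2, repair (D2); design owner's N3B-RUNG §7).  The kit layers of the From machinery move DERIVED cell/frame maps `F` by `Skelφ.QStepsN G F N`
(«SkelPhiQStepsN»): unit moves through links of length `≤ N` with EXACT inner footprint.  Under φ-quasi-steps that footprint cannot survive (the track wiggles by one unit), but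
the following does, and it is what the fat-link re-reading (D2) consumes: **`Skelφ.PsiSteps.exists_walk_cellStep`** — for `hq : PsiSteps G ψ M`, `2 ≤ K`, every vertex `w`,
axis `i`, sign `σ`: a vertex `w′` and a walk `w ⇝ w′` of length `≤ M·K` with `⌊ψ w′ / K⌋ = ⌊ψ w / K⌋ + σ eᵢ` EXACTLY and `|⌊ψ u j / K⌋ − ⌊ψ w j / K⌋| ≤ 1` for every vertex `u` of
the walk and both `j`.  Proof: aim at the nearest point of the target cell on the axis through `ψ w` (`r₀ ≤ K` units away) with `PsiSteps.exists_walk_eq` (track in the hull of the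
two endpoints widened by one) and read the cells of the widened hull (`K ≥ 2` keeps the overshoot `+1` inside the target cell).
* §1 floor-division bookkeeping (`ediv_le_of_lt`, `le_ediv_of_le`, `abs_cell_sub_le_of_near`, `l1_add_single`); §2 **`PsiSteps.exists_walk_cellStep`**, `PsiSteps.exists_mem_graphBall_cellStep`.
[cite: KozmaNitzan2024, §4 Lemma 10 Step III (p. 19), p. 26 ((29))] [cite: MartineauTassion2017, §4.3]
-/

noncomputable section

namespace Summit.CriticalPhenomena.PercolationContinuityZ3.Theorems.Transplant

namespace Skelφ

open SimpleGraph Literature.Probability.LatticeModels Literature.Probability.Percolation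
open Literature.Barriers.CriticalPhenomena (graphBall)
open scoped Classical

variable {V : Type} {G : SimpleGraph V} {ψ : V → Site 2} {M : ℕ}

/-! ## §1 Floor division by `K ≥ 2` on a widened hull -/

/-- `x < k (a + 1)` gives `x / k ≤ a` (`0 < k`). [folklore] -/
theorem ediv_le_of_lt {k a x : ℤ} (hk : 0 < k) (h : x < k * (a + 1)) : x / k ≤ a :=
  Int.lt_add_one_iff.1 ((Int.ediv_lt_iff_lt_mul hk).2 (by rwa [mul_comm] at h))

/-- `k a ≤ x` gives `a ≤ x / k` (`0 < k`). [folklore] -/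
theorem le_ediv_of_le {k a x : ℤ} (hk : 0 < k) (h : k * a ≤ x) : a ≤ x / k :=
  (Int.le_ediv_iff_mul_le hk).2 (by rwa [mul_comm] at h)

/-- **Cells of a widened unit hull**: if `z` lies within one unit of the segment between `x` and a point `x′` of the SAME cell or of the cell of `x` shifted by the overshoot
rule below, its cell is within one of the cell of `x`.  Precisely: `x − 1 ≤ z ≤ x + 1` ⟹ `|⌊z/k⌋ − ⌊x/k⌋| ≤ 1` for `k ≥ 2`. [folklore] -/
theorem abs_cell_sub_le_of_near {k : ℤ} (hk : 2 ≤ k) {x z : ℤ} (h1 : x - 1 ≤ z) (h2 : z ≤ x + 1) : |z / k - x / k| ≤ 1 := by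
  have hk0 : 0 < k := by omega
  have b0 := Int.mul_ediv_add_emod x k
  have bm := Int.emod_nonneg x hk0.ne'
  have bM := Int.emod_lt_of_pos x hk0
  have b1 : k * (x / k) ≤ x := by omega
  have b2 : x < k * (x / k) + k := by omega
  rw [abs_le]
  constructor
  · have : x / k - 1 ≤ z / k := le_ediv_of_le hk0 (by linarith)
    linarith
  · have : z / k ≤ x / k + 1 := ediv_le_of_lt hk0 (by linarith)
    linarith

/-- The ℓ¹ length of an axis displacement. [folklore] -/
theorem l1_add_single (x : Site 2) (i : Fin 2) (a : ℤ) : l1 (x + Pi.single i a) x = a.natAbs := by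
  fin_cases i <;> simp [l1]

/-! ## §2 Unit moves of the cell map with exact end cell and fat footprint -/

/-- **THEOREM (device (D2), coarse cell maps): quasi-steps of `ψ` move the `K`-cell map `⌊ψ/K⌋` (`K ≥ 2`) by one cell in any direction through a walk of length `≤ M·K`
whose vertices all lie in cells within `±1` of the start cell (both coordinates), the END cell being EXACTLY the neighbouring cell.**
[cite: KozmaNitzan2024, §4 Lemma 10 Step III (p. 19)] [cite: MartineauTassion2017, §4.3] -/
theorem PsiSteps.exists_walk_cellStep (hq : PsiSteps G ψ M) {K : ℕ} (hK : 2 ≤ K) (w : V) (i : Fin 2) (σ : ℤˣ) :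
    ∃ (w' : V) (p : G.Walk w w'), p.length ≤ M * K ∧
      (fun j => ψ w' j / (K : ℤ)) = (fun j => ψ w j / (K : ℤ)) + Pi.single i (σ : ℤ) ∧
      ∀ u ∈ p.support, ∀ j : Fin 2, |ψ u j / (K : ℤ) - ψ w j / (K : ℤ)| ≤ 1 := by
  set k : ℤ := (K : ℤ) with hkdef
  have hk2 : 2 ≤ k := by rw [hkdef]; exact_mod_cast hK
  have hk0 : 0 < k := by omega
  set x : ℤ := ψ w i with hxdef
  set c : ℤ := x / k with hcdef
  have b0 := Int.mul_ediv_add_emod x k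
  have bm := Int.emod_nonneg x hk0.ne'
  have bM := Int.emod_lt_of_pos x hk0
  have b1 : k * c ≤ x := by rw [hcdef]; omega
  have b2 : x < k * c + k := by rw [hcdef]; omega
  -- the signed distance `r₀ ∈ [1, k]` to the nearest axis point of the target cell, and that point's coordinate `x′`
  obtain ⟨r₀, x', hr1, hrk, hx', hcell', hlo, hhi⟩ : ∃ r₀ x' : ℤ, 1 ≤ r₀ ∧ r₀ ≤ k ∧ x' = x + (σ : ℤ) * r₀ ∧ x' / k = c + (σ : ℤ) ∧
      (∀ z, min x x' - 1 ≤ z → c - 1 ≤ z / k) ∧ (∀ z, z ≤ max x x' + 1 → z / k ≤ c + 1) := by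
    rcases Int.units_eq_one_or σ with hσ | hσ
    · -- upward: aim at `k (c + 1)`
      refine ⟨k * (c + 1) - x, k * (c + 1), by linarith, by linarith, by rw [hσ, Units.val_one, one_mul]; ring, ?_, fun z hz => ?_, fun z hz => ?_⟩
      · rw [hσ, Units.val_one, Int.mul_ediv_cancel_left _ hk0.ne']
      · have hmin : min x (k * (c + 1)) = x := min_eq_left (by linarith)
        rw [hmin] at hz
        exact le_ediv_of_le hk0 (by linarith)
      · have hmax : max x (k * (c + 1)) = k * (c + 1) := max_eq_right (by linarith)
        rw [hmax] at hz
        exact ediv_le_of_lt hk0 (by linarith)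
    · -- downward: aim at `k c − 1`
      refine ⟨x - (k * c - 1), k * c - 1, by linarith, by linarith, by rw [hσ, Units.val_neg, Units.val_one]; ring, ?_, fun z hz => ?_, fun z hz => ?_⟩
      · rw [hσ, Units.val_neg, Units.val_one]
        have e : k * c - 1 = (k - 1) + k * (c + -1) := by ring
        rw [e, Int.add_mul_ediv_left _ _ hk0.ne', Int.ediv_eq_zero_of_lt (by omega) (by omega), zero_add]
      · have hmin : min x (k * c - 1) = k * c - 1 := min_eq_right (by linarith)
        rw [hmin] at hz
        exact le_ediv_of_le hk0 (by linarith)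
      · have hmax : max x (k * c - 1) = x := max_eq_left (by linarith)
        rw [hmax] at hz
        exact ediv_le_of_lt hk0 (by linarith)
  -- the target point and the realising walk
  set y : Site 2 := ψ w + Pi.single i ((σ : ℤ) * r₀) with hydef
  have hyi : y i = x' := by rw [hydef, hx', Pi.add_apply, Pi.single_eq_same]
  have hyj : ∀ j, j ≠ i → y j = ψ w j := fun j hj => by rw [hydef, Pi.add_apply, Pi.single_eq_of_ne hj, add_zero]
  obtain ⟨w', hw', p, hp, htr⟩ := hq.exists_walk_eq w y
  have hl1 : l1 y (ψ w) ≤ K := by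
    rw [hydef, l1_add_single]
    rcases Int.units_eq_one_or σ with hσ | hσ
    · rw [hσ, Units.val_one, one_mul]; omega
    · rw [hσ, Units.val_neg, Units.val_one, neg_one_mul, Int.natAbs_neg]; omega
  refine ⟨w', p, hp.trans (Nat.mul_le_mul_left M hl1), funext fun j => ?_, fun u hu j => ?_⟩
  · -- exact end cell
    simp only [Pi.add_apply]
    by_cases hj : j = i
    · subst hj; rw [hw', hyi, hcell', Pi.single_eq_same]
    · rw [hw', hyj j hj, Pi.single_eq_of_ne hj, add_zero]
  · -- fat footprint
    obtain ⟨h1, h2⟩ := htr u hu j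
    by_cases hj : j = i
    · subst hj
      rw [hyi] at h1 h2
      rw [abs_le]
      exact ⟨by linarith [hlo _ h1], by linarith [hhi _ h2]⟩
    · rw [hyj j hj, min_self, max_self] at *
      exact abs_cell_sub_le_of_near hk2 h1 h2

/-- The end vertex of the cell move lies within graph distance `M·K`. [folklore] -/
theorem PsiSteps.exists_mem_graphBall_cellStep (hq : PsiSteps G ψ M) {K : ℕ} (hK : 2 ≤ K) (w : V) (i : Fin 2) (σ : ℤˣ) :
    ∃ w' : V, w' ∈ graphBall G w (M * K) ∧ (fun j => ψ w' j / (K : ℤ)) = (fun j => ψ w j / (K : ℤ)) + Pi.single i (σ : ℤ) := by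
  obtain ⟨w', p, hp, hcell, -⟩ := hq.exists_walk_cellStep hK w i σ
  exact ⟨w', ⟨p, hp⟩, hcell⟩

end Skelφ

end Summit.CriticalPhenomena.PercolationContinuityZ3.Theorems.Transplant

end
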